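import Summits.ValiantsHypothesis.ValiantsHypothesis.Theorems.KPlusLogSqLawTropicalBMarkedEdgeCoreHeightFn
import Summits.ValiantsHypothesis.ValiantsHypothesis.Theorems.KPlusLogSqLawTropicalBMarkedEdgeCoreFourUnion

/-!
# Route «KPlusLogSqLaw», crux `TropicalB` (stmt-ValiantsHypothesis-19771) — MARKED-EDGE sector, NESTED-TRIANGLE CORE, ALL sizes:
# closed rising walks are covers — the walk exclusions in REACHABILITY form

HONEST FRAMING.  Helper file (cell `pub-symmetroid`, seat val-sym-trop-p4 (g21), 2026-08-29; `--supports stmt-ValiantsHypothesis-19771 --as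
helper`).  Infrastructure for THEOREM D1 / K1 (memo HOME/val-sym-trop-p4/g21/RIGIDITY-g21.md §1): a closed walk `t = f 0 → f 1 → … → f n = t`
through the gate `t = b0` whose inner nodes avoid both gates and whose steps are relative arcs (`σZ (f (i+1)) ∈ {σB (f i), σC (f i), σE (f i)}`)
has distinct nodes (heights, `core_exists_height`) and hence IS a cover `σZ · formPerm` inside `σB ⊎ σC ⊎ σE ⊎ σZ` using the loop at `b4`
and moving `b0` (`cover_of_closedWalk`).  Consequently the kernel's b4-rigidity `core_BCEZ_four_three` reads: no such walk passes the marked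
arc `b3 → σZ⁻¹ b3` (`core_noWalk_three`); likewise the pair versions `core_noWalkCE` (marks b1, b2, b3), `core_noWalkBE` (b1, b3),
`core_noWalkBC` (b2, b3) from `core_CEZ_four`, `core_BEZ_four`, `core_BCZ_four`.  Nothing here proves the nested-triangle law; nothing concerns `TropicalB` in its window,
`WeakLifting`, the doors, `MatrixDescartes` (stmt-ValiantsHypothesis-18050) or VP ≠ VNP.
-/

set_option linter.dupNamespace false
set_option autoImplicit false

namespace Summit.ValiantsHypothesis.ValiantsHypothesis.Theorems.KPlusLogSqLaw
namespace MarkedEdge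
namespace Core

open Finset

variable {V : Type*} [Fintype V] [DecidableEq V]

omit [Fintype V] [DecidableEq V] in
/-- **A walk with increasing heights after its start is a simple cycle list.**  `f 0 = t`, `f i ≠ t` for `1 ≤ i < n`, and `h (f i) < h (f j)`
for `1 ≤ i < j < n`: the list `[f 0, …, f (n-1)]` has no duplicates. [folklore] -/
theorem nodup_ofFn_of_heights (f : ℕ → V) (h : V → ℕ) (t : V) (n : ℕ) (h0 : f 0 = t) (ht : ∀ i, 1 ≤ i → i < n → f i ≠ t)
    (hmono : ∀ i j, 1 ≤ i → i < j → j < n → h (f i) < h (f j)) :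
    (List.ofFn (fun k : Fin n => f k)).Nodup := by
  rw [List.nodup_ofFn]
  intro k₁ k₂ hk
  dsimp only at hk
  rcases lt_trichotomy (k₁ : ℕ) k₂ with hlt | heq | hgt
  · exfalso
    rcases Nat.eq_zero_or_pos k₁ with h1 | h1
    · exact ht k₂ (by omega) k₂.isLt (by rw [← hk, h1, h0])
    · exact absurd hk (fun h' => (hmono k₁ k₂ h1 hlt k₂.isLt).ne (by rw [h']))
  · exact Fin.ext heq
  · exfalso
    rcases Nat.eq_zero_or_pos k₂ with h2 | h2
    · exact ht k₁ (by omega) k₁.isLt (by rw [hk, h2, h0])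
    · exact absurd hk (fun h' => (hmono k₂ k₁ h2 hgt k₁.isLt).ne (by rw [h']))

omit [Fintype V] in
/-- **Cover of a closed walk.**  For a closed walk `f 0, …, f n = f 0` (`n ≥ 2`) with distinct nodes `f 0, …, f (n-1)`, the permutation
`T = σZ · formPerm [f 0, …, f (n-1)]` satisfies `T (f i) = σZ (f (i+1))` for `i < n` and `T v = σZ v` off the walk. [folklore] -/
theorem cover_of_closedWalk (σZ : Equiv.Perm V) (f : ℕ → V) (n : ℕ) (hn : 2 ≤ n) (hclosed : f n = f 0)
    (hnd : (List.ofFn (fun k : Fin n => f k)).Nodup) :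
    ∃ T : Equiv.Perm V, (∀ i, i < n → T (f i) = σZ (f (i + 1))) ∧ (∀ v, (∀ i, i < n → f i ≠ v) → T v = σZ v) ∧ T ≠ σZ := by
  set l : List V := List.ofFn (fun k : Fin n => f k) with hl
  have hlen : l.length = n := by simp [hl]
  refine ⟨σZ * l.formPerm, fun i hi => ?_, fun v hv => ?_, fun hEq => ?_⟩
  · rw [Equiv.Perm.mul_apply]
    have hget : l[i]'(by rw [hlen]; exact hi) = f i := by simp [hl]
    rw [← hget, List.formPerm_apply_getElem l hnd i (by rw [hlen]; exact hi)]
    simp only [hl, List.getElem_ofFn, List.length_ofFn]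
    by_cases hi1 : i + 1 < n
    · rw [Nat.mod_eq_of_lt hi1]
    · have : i + 1 = n := by omega
      rw [this, Nat.mod_self, ← hclosed]
  · rw [Equiv.Perm.mul_apply, List.formPerm_apply_of_notMem]
    intro hm
    rw [hl, List.mem_ofFn] at hm
    obtain ⟨k, hk⟩ := hm
    exact hv k k.isLt hk
  · have h1 : σZ * l.formPerm = σZ * 1 := by rw [mul_one]; exact hEq
    have := (List.formPerm_eq_one_iff l hnd).mp (mul_left_cancel h1)
    omega


section Core

variable (ok : V → V → Prop) (w g : V → V → ℤ) (b : Fin 5 → V)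

/-- **The cover of a closed rising walk.**  In a realisation, a closed walk `b0 = f 0 → … → f n = b0` (`n ≥ 2`, inner nodes off the gates,
no repeated consecutive node) along relative arcs of `σB, σC, σE` has increasing heights, hence distinct nodes, and `T = σZ · formPerm` is a
permutation with `T (f i) = σZ (f (i+1))`, `T = σZ` off the walk, `T b4 = b4`, `T b0 ≠ b0`. [this seat's theorem] -/
theorem core_walkCover (hb : Function.Injective b)
    (hoff : ∀ i j, j ≠ i → g i j = 0) (hmark : ∀ l, g (b l) (b l) = (2 : ℤ) ^ (l : ℕ)) (haux : ∀ i, (∀ l, b l ≠ i) → g i i = 0)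
    {θB θC θE θZ : ℤ} {σB σC σE σZ : Equiv.Perm V} (hBC : θB < θC) (hCE : θC < θE) (hEZ : θE < θZ)
    (hB : (∀ i, ok i (σB i)) ∧ ∀ τ : Equiv.Perm V, τ ≠ σB → (∀ i, ok i (τ i)) →
      ∑ i, (w i (τ i) + θB * g i (τ i)) < ∑ i, (w i (σB i) + θB * g i (σB i)))
    (hC : (∀ i, ok i (σC i)) ∧ ∀ τ : Equiv.Perm V, τ ≠ σC → (∀ i, ok i (τ i)) →
      ∑ i, (w i (τ i) + θC * g i (τ i)) < ∑ i, (w i (σC i) + θC * g i (σC i)))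
    (hE : (∀ i, ok i (σE i)) ∧ ∀ τ : Equiv.Perm V, τ ≠ σE → (∀ i, ok i (τ i)) →
      ∑ i, (w i (τ i) + θE * g i (τ i)) < ∑ i, (w i (σE i) + θE * g i (σE i)))
    (hZ : (∀ i, ok i (σZ i)) ∧ ∀ τ : Equiv.Perm V, τ ≠ σZ → (∀ i, ok i (τ i)) →
      ∑ i, (w i (τ i) + θZ * g i (τ i)) < ∑ i, (w i (σZ i) + θZ * g i (σZ i)))
    (hB0 : σB (b 0) ≠ b 0) (hB1 : σB (b 1) = b 1) (hB2 : σB (b 2) = b 2) (hB3 : σB (b 3) ≠ b 3) (hB4 : σB (b 4) ≠ b 4)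
    (hC0 : σC (b 0) ≠ b 0) (hC1 : σC (b 1) = b 1) (hC2 : σC (b 2) ≠ b 2) (hC3 : σC (b 3) = b 3) (hC4 : σC (b 4) ≠ b 4)
    (hE0 : σE (b 0) ≠ b 0) (hE1 : σE (b 1) ≠ b 1) (hE2 : σE (b 2) = b 2) (hE3 : σE (b 3) = b 3) (hE4 : σE (b 4) ≠ b 4)
    (hZ0 : σZ (b 0) = b 0) (hZ1 : σZ (b 1) ≠ b 1) (hZ2 : σZ (b 2) ≠ b 2) (hZ3 : σZ (b 3) ≠ b 3) (hZ4 : σZ (b 4) = b 4)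
    (f : ℕ → V) (n : ℕ) (hn : 2 ≤ n) (h0 : f 0 = b 0) (hclosed : f n = b 0)
    (hW : ∀ i, 1 ≤ i → i < n → f i ≠ b 0 ∧ f i ≠ b 4) (hne : ∀ i, i < n → f (i + 1) ≠ f i)
    (harc : ∀ i, i < n → σZ (f (i + 1)) = σB (f i) ∨ σZ (f (i + 1)) = σC (f i) ∨ σZ (f (i + 1)) = σE (f i)) :
    ∃ T : Equiv.Perm V, (∀ i, i < n → T (f i) = σZ (f (i + 1))) ∧ (∀ v, (∀ i, i < n → f i ≠ v) → T v = σZ v) ∧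
      T (b 4) = b 4 ∧ T (b 0) ≠ b 0 := by
  obtain ⟨h, hh⟩ := core_exists_height ok w g b hb hoff hmark haux hBC hCE hEZ hB hC hE hZ hB0 hB1 hB2 hB3 hB4 hC0 hC1 hC2 hC3 hC4
    hE0 hE1 hE2 hE3 hE4 hZ0 hZ1 hZ2 hZ3 hZ4
  have hstep : ∀ i, 1 ≤ i → i + 1 < n → h (f i) < h (f (i + 1)) := by
    intro i hi1 hi2
    have hWi := hW i hi1 (by omega); have hWi1 := hW (i + 1) (by omega) hi2
    exact hh (f i) (f (i + 1)) hWi.1 hWi.2 hWi1.1 hWi1.2 (fun h' => hne i (by omega) h'.symm) (harc i (by omega))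
  have hmono : ∀ i j, 1 ≤ i → i < j → j < n → h (f i) < h (f j) := by
    intro i j hi hij hj
    induction j with
    | zero => omega
    | succ j ih =>
      rcases Nat.eq_or_lt_of_le (Nat.le_of_lt_succ hij) with hEq | hlt
      · rw [← hEq]; exact hstep i hi (by omega)
      · exact (ih hlt (by omega)).trans (hstep j (by omega) hj)
  have hnd := nodup_ofFn_of_heights f h (b 0) n h0 (fun i hi1 hi2 => (hW i hi1 hi2).1) hmono
  obtain ⟨T, hTf, hToff, -⟩ := cover_of_closedWalk σZ f n hn (by rw [hclosed, h0]) hnd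
  refine ⟨T, hTf, hToff, ?_, ?_⟩
  · rw [hToff (b 4) fun i hi => ?_, hZ4]
    rcases Nat.eq_zero_or_pos i with h0' | hpos
    · rw [h0', h0]; exact fun h' => hb.ne (by decide : (0 : Fin 5) ≠ 4) h'
    · exact (hW i hpos hi).2
  · rw [← h0, hTf 0 (by omega), zero_add]
    intro h'
    rw [h0, ← hZ0] at h'
    exact (hW 1 le_rfl (by omega)).1 (σZ.injective h')

/-- **No closed rising walk through the arc `b3 → σZ⁻¹ b3` (reachability form of `core_BCEZ_four_three`).**  In a realisation of the
nested-triangle core, no closed walk `b0 = f 0 → … → f n = b0` as in `core_walkCover` (three relative colours allowed) passes `f a = b3`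
with `σZ (f (a+1)) = b3`.  Reading: «b3 reachable from b0 AND b0 reachable from σZ⁻¹ b3 by rising three-colour paths» is impossible. [this seat's theorem] -/
theorem core_noWalk_three (hb : Function.Injective b)
    (hoff : ∀ i j, j ≠ i → g i j = 0) (hmark : ∀ l, g (b l) (b l) = (2 : ℤ) ^ (l : ℕ)) (haux : ∀ i, (∀ l, b l ≠ i) → g i i = 0)
    {θB θC θE θZ : ℤ} {σB σC σE σZ : Equiv.Perm V} (hBC : θB < θC) (hCE : θC < θE) (hEZ : θE < θZ)
    (hB : (∀ i, ok i (σB i)) ∧ ∀ τ : Equiv.Perm V, τ ≠ σB → (∀ i, ok i (τ i)) →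
      ∑ i, (w i (τ i) + θB * g i (τ i)) < ∑ i, (w i (σB i) + θB * g i (σB i)))
    (hC : (∀ i, ok i (σC i)) ∧ ∀ τ : Equiv.Perm V, τ ≠ σC → (∀ i, ok i (τ i)) →
      ∑ i, (w i (τ i) + θC * g i (τ i)) < ∑ i, (w i (σC i) + θC * g i (σC i)))
    (hE : (∀ i, ok i (σE i)) ∧ ∀ τ : Equiv.Perm V, τ ≠ σE → (∀ i, ok i (τ i)) →
      ∑ i, (w i (τ i) + θE * g i (τ i)) < ∑ i, (w i (σE i) + θE * g i (σE i)))
    (hZ : (∀ i, ok i (σZ i)) ∧ ∀ τ : Equiv.Perm V, τ ≠ σZ → (∀ i, ok i (τ i)) →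
      ∑ i, (w i (τ i) + θZ * g i (τ i)) < ∑ i, (w i (σZ i) + θZ * g i (σZ i)))
    (hB0 : σB (b 0) ≠ b 0) (hB1 : σB (b 1) = b 1) (hB2 : σB (b 2) = b 2) (hB3 : σB (b 3) ≠ b 3) (hB4 : σB (b 4) ≠ b 4)
    (hC0 : σC (b 0) ≠ b 0) (hC1 : σC (b 1) = b 1) (hC2 : σC (b 2) ≠ b 2) (hC3 : σC (b 3) = b 3) (hC4 : σC (b 4) ≠ b 4)
    (hE0 : σE (b 0) ≠ b 0) (hE1 : σE (b 1) ≠ b 1) (hE2 : σE (b 2) = b 2) (hE3 : σE (b 3) = b 3) (hE4 : σE (b 4) ≠ b 4)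
    (hZ0 : σZ (b 0) = b 0) (hZ1 : σZ (b 1) ≠ b 1) (hZ2 : σZ (b 2) ≠ b 2) (hZ3 : σZ (b 3) ≠ b 3) (hZ4 : σZ (b 4) = b 4)
    (f : ℕ → V) (n : ℕ) (hn : 2 ≤ n) (h0 : f 0 = b 0) (hclosed : f n = b 0)
    (hW : ∀ i, 1 ≤ i → i < n → f i ≠ b 0 ∧ f i ≠ b 4) (hne : ∀ i, i < n → f (i + 1) ≠ f i)
    (harc : ∀ i, i < n → σZ (f (i + 1)) = σB (f i) ∨ σZ (f (i + 1)) = σC (f i) ∨ σZ (f (i + 1)) = σE (f i))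
    {a : ℕ} (ha : a < n) (hfa : f a = b 3) (hfa1 : σZ (f (a + 1)) = b 3) : False := by
  obtain ⟨T, hTf, hToff, hT4, hT0⟩ := core_walkCover ok w g b hb hoff hmark haux hBC hCE hEZ hB hC hE hZ hB0 hB1 hB2 hB3 hB4 hC0 hC1 hC2 hC3 hC4
    hE0 hE1 hE2 hE3 hE4 hZ0 hZ1 hZ2 hZ3 hZ4 f n hn h0 hclosed hW hne harc
  have hT : ∀ v, T v = σB v ∨ T v = σC v ∨ T v = σE v ∨ T v = σZ v := by
    intro v
    by_cases hv : ∃ i, i < n ∧ f i = v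
    · obtain ⟨i, hi, rfl⟩ := hv
      rw [hTf i hi]
      rcases harc i hi with h' | h' | h'
      · exact Or.inl h'
      · exact Or.inr (Or.inl h')
      · exact Or.inr (Or.inr (Or.inl h'))
    · push Not at hv
      exact Or.inr (Or.inr (Or.inr (hToff v fun i hi => hv i hi)))
  have hT3 : T (b 3) = b 3 := by have h3 := hTf a ha; rwa [hfa, hfa1] at h3
  exact core_BCEZ_four_three ok w g b hb hoff hmark haux hBC hCE hEZ hB hC hE hZ hB0 hB1 hB2 hB3 hB4 hC0 hC1 hC2 hC3 hC4
    hE0 hE1 hE2 hE3 hE4 hZ0 hZ1 hZ2 hZ3 hZ4 T hT hT4 hT0 hT3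

/-- **No closed rising `σC/σE`-walk through a marked arc (reachability form of `core_CEZ_four`).**  With only the relative colours of `σC`
and `σE` allowed on the walk, none of the arcs `b_l → σZ⁻¹ b_l` (`l = 1, 2, 3`) can occur. [this seat's theorem] -/
theorem core_noWalkCE (hb : Function.Injective b)
    (hoff : ∀ i j, j ≠ i → g i j = 0) (hmark : ∀ l, g (b l) (b l) = (2 : ℤ) ^ (l : ℕ)) (haux : ∀ i, (∀ l, b l ≠ i) → g i i = 0)
    {θB θC θE θZ : ℤ} {σB σC σE σZ : Equiv.Perm V} (hBC : θB < θC) (hCE : θC < θE) (hEZ : θE < θZ)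
    (hB : (∀ i, ok i (σB i)) ∧ ∀ τ : Equiv.Perm V, τ ≠ σB → (∀ i, ok i (τ i)) →
      ∑ i, (w i (τ i) + θB * g i (τ i)) < ∑ i, (w i (σB i) + θB * g i (σB i)))
    (hC : (∀ i, ok i (σC i)) ∧ ∀ τ : Equiv.Perm V, τ ≠ σC → (∀ i, ok i (τ i)) →
      ∑ i, (w i (τ i) + θC * g i (τ i)) < ∑ i, (w i (σC i) + θC * g i (σC i)))
    (hE : (∀ i, ok i (σE i)) ∧ ∀ τ : Equiv.Perm V, τ ≠ σE → (∀ i, ok i (τ i)) →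
      ∑ i, (w i (τ i) + θE * g i (τ i)) < ∑ i, (w i (σE i) + θE * g i (σE i)))
    (hZ : (∀ i, ok i (σZ i)) ∧ ∀ τ : Equiv.Perm V, τ ≠ σZ → (∀ i, ok i (τ i)) →
      ∑ i, (w i (τ i) + θZ * g i (τ i)) < ∑ i, (w i (σZ i) + θZ * g i (σZ i)))
    (hB0 : σB (b 0) ≠ b 0) (hB1 : σB (b 1) = b 1) (hB2 : σB (b 2) = b 2) (hB3 : σB (b 3) ≠ b 3) (hB4 : σB (b 4) ≠ b 4)
    (hC0 : σC (b 0) ≠ b 0) (hC1 : σC (b 1) = b 1) (hC2 : σC (b 2) ≠ b 2) (hC3 : σC (b 3) = b 3) (hC4 : σC (b 4) ≠ b 4)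
    (hE0 : σE (b 0) ≠ b 0) (hE1 : σE (b 1) ≠ b 1) (hE2 : σE (b 2) = b 2) (hE3 : σE (b 3) = b 3) (hE4 : σE (b 4) ≠ b 4)
    (hZ0 : σZ (b 0) = b 0) (hZ1 : σZ (b 1) ≠ b 1) (hZ2 : σZ (b 2) ≠ b 2) (hZ3 : σZ (b 3) ≠ b 3) (hZ4 : σZ (b 4) = b 4)
    (f : ℕ → V) (n : ℕ) (hn : 2 ≤ n) (h0 : f 0 = b 0) (hclosed : f n = b 0)
    (hW : ∀ i, 1 ≤ i → i < n → f i ≠ b 0 ∧ f i ≠ b 4) (hne : ∀ i, i < n → f (i + 1) ≠ f i)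
    (harc : ∀ i, i < n → σZ (f (i + 1)) = σC (f i) ∨ σZ (f (i + 1)) = σE (f i))
    {a : ℕ} (ha : a < n) {l : Fin 5} (hl : l = 1 ∨ l = 2 ∨ l = 3) (hfa : f a = b l) (hfa1 : σZ (f (a + 1)) = b l) : False := by
  obtain ⟨T, hTf, hToff, hT4, hT0⟩ := core_walkCover ok w g b hb hoff hmark haux hBC hCE hEZ hB hC hE hZ hB0 hB1 hB2 hB3 hB4 hC0 hC1 hC2 hC3 hC4
    hE0 hE1 hE2 hE3 hE4 hZ0 hZ1 hZ2 hZ3 hZ4 f n hn h0 hclosed hW hne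
    (fun i hi => Or.inr (harc i hi))
  have hT : ∀ v, T v = σC v ∨ T v = σE v ∨ T v = σZ v := by
    intro v
    by_cases hv : ∃ i, i < n ∧ f i = v
    · obtain ⟨i, hi, rfl⟩ := hv
      rw [hTf i hi]
      rcases harc i hi with h' | h'
      · exact Or.inl h'
      · exact Or.inr (Or.inl h')
    · push Not at hv
      exact Or.inr (Or.inr (hToff v fun i hi => hv i hi))
  have hTl : T (b l) = b l := by have h3 := hTf a ha; rwa [hfa, hfa1] at h3
  have key := core_CEZ_four ok w g b hb hoff hmark haux hCE hEZ hC hE hZ hC0 hC1 hC2 hC3 hC4 hE0 hE1 hE2 hE3 hE4 hZ0 hZ1 hZ2 hZ3 hZ4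
    T hT hT4 hT0
  rcases hl with rfl | rfl | rfl
  · exact key.1 hTl
  · exact key.2.1 hTl
  · exact key.2.2 hTl

/-- **No closed rising `σB/σE`-walk through `b1 → σZ⁻¹ b1` or `b3 → σZ⁻¹ b3` (reachability form of `core_BEZ_four`).** [this seat's theorem] -/
theorem core_noWalkBE (hb : Function.Injective b)
    (hoff : ∀ i j, j ≠ i → g i j = 0) (hmark : ∀ l, g (b l) (b l) = (2 : ℤ) ^ (l : ℕ)) (haux : ∀ i, (∀ l, b l ≠ i) → g i i = 0)
    {θB θC θE θZ : ℤ} {σB σC σE σZ : Equiv.Perm V} (hBC : θB < θC) (hCE : θC < θE) (hEZ : θE < θZ)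
    (hB : (∀ i, ok i (σB i)) ∧ ∀ τ : Equiv.Perm V, τ ≠ σB → (∀ i, ok i (τ i)) →
      ∑ i, (w i (τ i) + θB * g i (τ i)) < ∑ i, (w i (σB i) + θB * g i (σB i)))
    (hC : (∀ i, ok i (σC i)) ∧ ∀ τ : Equiv.Perm V, τ ≠ σC → (∀ i, ok i (τ i)) →
      ∑ i, (w i (τ i) + θC * g i (τ i)) < ∑ i, (w i (σC i) + θC * g i (σC i)))
    (hE : (∀ i, ok i (σE i)) ∧ ∀ τ : Equiv.Perm V, τ ≠ σE → (∀ i, ok i (τ i)) →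
      ∑ i, (w i (τ i) + θE * g i (τ i)) < ∑ i, (w i (σE i) + θE * g i (σE i)))
    (hZ : (∀ i, ok i (σZ i)) ∧ ∀ τ : Equiv.Perm V, τ ≠ σZ → (∀ i, ok i (τ i)) →
      ∑ i, (w i (τ i) + θZ * g i (τ i)) < ∑ i, (w i (σZ i) + θZ * g i (σZ i)))
    (hB0 : σB (b 0) ≠ b 0) (hB1 : σB (b 1) = b 1) (hB2 : σB (b 2) = b 2) (hB3 : σB (b 3) ≠ b 3) (hB4 : σB (b 4) ≠ b 4)
    (hC0 : σC (b 0) ≠ b 0) (hC1 : σC (b 1) = b 1) (hC2 : σC (b 2) ≠ b 2) (hC3 : σC (b 3) = b 3) (hC4 : σC (b 4) ≠ b 4)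
    (hE0 : σE (b 0) ≠ b 0) (hE1 : σE (b 1) ≠ b 1) (hE2 : σE (b 2) = b 2) (hE3 : σE (b 3) = b 3) (hE4 : σE (b 4) ≠ b 4)
    (hZ0 : σZ (b 0) = b 0) (hZ1 : σZ (b 1) ≠ b 1) (hZ2 : σZ (b 2) ≠ b 2) (hZ3 : σZ (b 3) ≠ b 3) (hZ4 : σZ (b 4) = b 4)
    (f : ℕ → V) (n : ℕ) (hn : 2 ≤ n) (h0 : f 0 = b 0) (hclosed : f n = b 0)
    (hW : ∀ i, 1 ≤ i → i < n → f i ≠ b 0 ∧ f i ≠ b 4) (hne : ∀ i, i < n → f (i + 1) ≠ f i)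
    (harc : ∀ i, i < n → σZ (f (i + 1)) = σB (f i) ∨ σZ (f (i + 1)) = σE (f i))
    {a : ℕ} (ha : a < n) {l : Fin 5} (hl : l = 1 ∨ l = 3) (hfa : f a = b l) (hfa1 : σZ (f (a + 1)) = b l) : False := by
  obtain ⟨T, hTf, hToff, hT4, hT0⟩ := core_walkCover ok w g b hb hoff hmark haux hBC hCE hEZ hB hC hE hZ hB0 hB1 hB2 hB3 hB4 hC0 hC1 hC2 hC3 hC4
    hE0 hE1 hE2 hE3 hE4 hZ0 hZ1 hZ2 hZ3 hZ4 f n hn h0 hclosed hW hne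
    (fun i hi => (harc i hi).elim Or.inl (fun h' => Or.inr (Or.inr h')))
  have hT : ∀ v, T v = σB v ∨ T v = σE v ∨ T v = σZ v := by
    intro v
    by_cases hv : ∃ i, i < n ∧ f i = v
    · obtain ⟨i, hi, rfl⟩ := hv
      rw [hTf i hi]
      rcases harc i hi with h' | h'
      · exact Or.inl h'
      · exact Or.inr (Or.inl h')
    · push Not at hv
      exact Or.inr (Or.inr (hToff v fun i hi => hv i hi))
  have hTl : T (b l) = b l := by have h3 := hTf a ha; rwa [hfa, hfa1] at h3
  have key := core_BEZ_four ok w g b hb hoff hmark haux (hBC.trans hCE) hEZ hB hE hZ hB0 hB1 hB2 hB3 hB4 hE0 hE1 hE3 hE4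
    hZ0 hZ1 hZ2 hZ3 hZ4 T hT hT4 hT0
  rcases hl with rfl | rfl
  · exact key.1 hTl
  · exact key.2 hTl

/-- **No closed rising `σB/σC`-walk through `b2 → σZ⁻¹ b2` or `b3 → σZ⁻¹ b3` (reachability form of `core_BCZ_four`).** [this seat's theorem] -/
theorem core_noWalkBC (hb : Function.Injective b)
    (hoff : ∀ i j, j ≠ i → g i j = 0) (hmark : ∀ l, g (b l) (b l) = (2 : ℤ) ^ (l : ℕ)) (haux : ∀ i, (∀ l, b l ≠ i) → g i i = 0)
    {θB θC θE θZ : ℤ} {σB σC σE σZ : Equiv.Perm V} (hBC : θB < θC) (hCE : θC < θE) (hEZ : θE < θZ)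
    (hB : (∀ i, ok i (σB i)) ∧ ∀ τ : Equiv.Perm V, τ ≠ σB → (∀ i, ok i (τ i)) →
      ∑ i, (w i (τ i) + θB * g i (τ i)) < ∑ i, (w i (σB i) + θB * g i (σB i)))
    (hC : (∀ i, ok i (σC i)) ∧ ∀ τ : Equiv.Perm V, τ ≠ σC → (∀ i, ok i (τ i)) →
      ∑ i, (w i (τ i) + θC * g i (τ i)) < ∑ i, (w i (σC i) + θC * g i (σC i)))
    (hE : (∀ i, ok i (σE i)) ∧ ∀ τ : Equiv.Perm V, τ ≠ σE → (∀ i, ok i (τ i)) →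
      ∑ i, (w i (τ i) + θE * g i (τ i)) < ∑ i, (w i (σE i) + θE * g i (σE i)))
    (hZ : (∀ i, ok i (σZ i)) ∧ ∀ τ : Equiv.Perm V, τ ≠ σZ → (∀ i, ok i (τ i)) →
      ∑ i, (w i (τ i) + θZ * g i (τ i)) < ∑ i, (w i (σZ i) + θZ * g i (σZ i)))
    (hB0 : σB (b 0) ≠ b 0) (hB1 : σB (b 1) = b 1) (hB2 : σB (b 2) = b 2) (hB3 : σB (b 3) ≠ b 3) (hB4 : σB (b 4) ≠ b 4)
    (hC0 : σC (b 0) ≠ b 0) (hC1 : σC (b 1) = b 1) (hC2 : σC (b 2) ≠ b 2) (hC3 : σC (b 3) = b 3) (hC4 : σC (b 4) ≠ b 4)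
    (hE0 : σE (b 0) ≠ b 0) (hE1 : σE (b 1) ≠ b 1) (hE2 : σE (b 2) = b 2) (hE3 : σE (b 3) = b 3) (hE4 : σE (b 4) ≠ b 4)
    (hZ0 : σZ (b 0) = b 0) (hZ1 : σZ (b 1) ≠ b 1) (hZ2 : σZ (b 2) ≠ b 2) (hZ3 : σZ (b 3) ≠ b 3) (hZ4 : σZ (b 4) = b 4)
    (f : ℕ → V) (n : ℕ) (hn : 2 ≤ n) (h0 : f 0 = b 0) (hclosed : f n = b 0)
    (hW : ∀ i, 1 ≤ i → i < n → f i ≠ b 0 ∧ f i ≠ b 4) (hne : ∀ i, i < n → f (i + 1) ≠ f i)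
    (harc : ∀ i, i < n → σZ (f (i + 1)) = σB (f i) ∨ σZ (f (i + 1)) = σC (f i))
    {a : ℕ} (ha : a < n) {l : Fin 5} (hl : l = 2 ∨ l = 3) (hfa : f a = b l) (hfa1 : σZ (f (a + 1)) = b l) : False := by
  obtain ⟨T, hTf, hToff, hT4, hT0⟩ := core_walkCover ok w g b hb hoff hmark haux hBC hCE hEZ hB hC hE hZ hB0 hB1 hB2 hB3 hB4 hC0 hC1 hC2 hC3 hC4
    hE0 hE1 hE2 hE3 hE4 hZ0 hZ1 hZ2 hZ3 hZ4 f n hn h0 hclosed hW hne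
    (fun i hi => (harc i hi).elim Or.inl (fun h' => Or.inr (Or.inl h')))
  have hT : ∀ v, T v = σB v ∨ T v = σC v ∨ T v = σZ v := by
    intro v
    by_cases hv : ∃ i, i < n ∧ f i = v
    · obtain ⟨i, hi, rfl⟩ := hv
      rw [hTf i hi]
      rcases harc i hi with h' | h'
      · exact Or.inl h'
      · exact Or.inr (Or.inl h')
    · push Not at hv
      exact Or.inr (Or.inr (hToff v fun i hi => hv i hi))
  have hTl : T (b l) = b l := by have h3 := hTf a ha; rwa [hfa, hfa1] at h3
  have key := core_BCZ_four ok w g b hb hoff hmark haux hBC (hCE.trans hEZ) hB hC hZ hB0 hB1 hB2 hB3 hB4 hC0 hC2 hC3 hC4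
    hZ0 hZ1 hZ2 hZ3 hZ4 T hT hT4 hT0
  rcases hl with rfl | rfl
  · exact key.1 hTl
  · exact key.2 hTl

end Core

end Core
end MarkedEdge
end Summit.ValiantsHypothesis.ValiantsHypothesis.Theorems.KPlusLogSqLaw
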